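import Literature.NumberTheory.EllipticCurves.SelmerFiniteProofs
import Literature.NumberTheory.GaloisRepresentations.UnramifiedKummer
import Literature.NumberTheory.Automorphic.AdicCompletionLocalField
import Mathlib.FieldTheory.Galois.Infinite
import HarnessLib

/-!
# The inertia group at a finite place and the maximal unramified extension `K_v^nr` of the tree
# (bridge `SelmerInertia` ↔ `GaloisRepresentations/UnramifiedKummer`)

`Proofs` file (theorems only). Two renderings of the same objects live in the tree:

* `SelmerInertia` / `SelmerFiniteProofs` / `ClosureValuation` (topic `EllipticCurves`): for a
  number field `K` and a finite place `v`, the local absolute integers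
  `v.localAbsIntegers = absIntegers 𝓞_v K_v ⊆ K̄_v` (`𝓞_v = v.adicCompletionIntegers K`,
  Mathlib's `ℤᵐ⁰`-valued `Valued` structure), their primes `𝔐 ∈ v.localPrimesAbove` and the
  inertia groups `𝔐.inertia Γ_{K_v}`, all read off the spectral valuation `|·|_v` (`w`, `hw`);
* `GaloisRepresentations/LocalGaloisGroup`, `InertiaRootsOfUnity`, `UnramifiedKummer` (trunk
  GalRep): for an abstract non-archimedean local field `F` (Mathlib `IsNonarchimedeanLocalField`,
  valuation ring `𝒪[F]` of its `ValuativeRel`), `absIntegers 𝒪[F] F`, the canonical prime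
  `absMaximalIdeal F`, the inertia group `Literature.absInertia F`, the norm `algNorm F` of `F̄`, and
  **`Literature.IsNonarchimedeanLocalField.maxUnramified F = F(μ_{p'})`, the maximal unramified
  extension**, with the theorems `mem_absInertia_iff_forall_mem_maxUnramified`
  (`I_F = Aut(F̄/F_nr)`) and `exists_algNorm_eq_zpow_of_mem_maxUnramified` (`F_nr/F` is
  unramified: every `x ≠ 0` of `F_nr` has `‖x‖ ∈ ‖ϖ‖^ℤ`; Serre, *Local Fields*, IV §4 Prop. 16,
  Cor. 2; Neukirch II (7.5)).

Since `K_v` *is* a non-archimedean local field (`Automorphic/AdicCompletionLocalField`: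
`instIsNonarchimedeanLocalFieldAdicCompletion`), the second applies to `F = K_v`; this file
identifies the two renderings and draws the consequences needed by `KodairaNeronUnramifiedProofs`
(Kodaira–Néron over `K_v^nr`, Silverman *AEC* VII.6.2 as used in the proof of VII.7.1):

* `mem_localAbsIntegers_iff_algNorm_le_one`, `spectralValuation_le_one_iff_algNorm_le_one`,
  `spectralValuation_lt_one_iff_algNorm_lt_one`: `\bar 𝓞_v` is the closed unit ball of
  `algNorm K_v` (the generic `ClosureValuation` lemma for the valuation norm
  `nontriviallyNormedField K_v` of the GalRep files, whose unit ball in `K_v` is again `𝓞_v`),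
  so the two norms `|·|_v` and `algNorm K_v` of `K̄_v` have the same unit balls and spheres;
* `inertia_eq_absInertia`: **`𝔐.inertia Γ_{K_v} = absInertia K_v`** for `𝔐 ∈ v.localPrimesAbove`;
* `mem_maxUnramified_iff_forall_inertia`: **the fixed field of `I_𝔐` in `K̄_v` is
  `maxUnramified K_v`** (Neukirch, *ANT*, II (9.10)–(9.11): the inertia field is the maximal
  unramified extension) — from `I_F = Aut(F̄/F_nr)` and the Galois correspondence for `K̄_v/K_v`
  (Mathlib `InfiniteGalois.fixedField_fixingSubgroup`);
* `exists_spectralValuation_eq_of_mem_maxUnramified`: **the value group of `K_v^nr` is that of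
  `K_v`** for the spectral valuation `|·|_v` (Neukirch II (7.5)): every `x ≠ 0` in
  `maxUnramified K_v` has `|x|_v = |a|_v` for some `a ∈ K_v` — from
  `exists_algNorm_eq_zpow_of_mem_maxUnramified`, the two norms of `K̄_v` having the same unit
  balls (`spectralValuation_eq_of_algNorm_eq`).

## References

* [NeukirchANT1999] J. Neukirch, *Algebraic Number Theory*, Springer 1999, Ch. II (4.8), (6.2),
  (7.5), (9.3), (9.10), (9.11) (PDF pp. 144, 161 of the held copy).
* [SerreLocalFields1979] J.-P. Serre, *Local Fields*, GTM 67, Ch. IV §4, Prop. 16 and Cor. 2.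
* [SilvermanAEC2009] J. H. Silverman, *The Arithmetic of Elliptic Curves*, 2nd ed., VII.§4
  (`K^nr`), proof of Thm. VII.7.1.

## Design

No definitions; `noncomputable section`; `open scoped Classical NNReal`; one universe `u`. The
valuation norm of the GalRep files is only ever introduced locally (`letI`), so no instance on
`v.adicCompletion K` is added; Mathlib's `Valued.v` on `K_v` is written with its type
`Valuation K_v ℤᵐ⁰` where both valued structures are in scope.
-/

noncomputable section

open scoped Classical NNReal
open NumberField IsDedekindDomain ValuativeRel Field

universe u

namespace IsDedekindDomain.HeightOneSpectrum

open Literature.NumberTheory.GaloisRepresentations Literature.NumberTheory.GaloisRepresentations.IsNonarchimedeanLocalField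

variable {K : Type u} [Field K] [NumberField K] (v : HeightOneSpectrum (𝓞 K))

/-! ## The two valuation rings of `K_v` and the two norms of `K̄_v` -/

/-- `𝓞_v = v.adicCompletionIntegers K` (Mathlib's `ℤᵐ⁰`-valued valuation) is the valuation ring
`𝒪[K_v]` of the valuative relation of `K_v` (`AdicCompletionLocalField`: the relation *of*
`Valued.v`). [folklore] -/
theorem mem_adicCompletionIntegers_iff_mem_integer (x : v.adicCompletion K) :
    x ∈ v.adicCompletionIntegers K ↔ x ∈ 𝒪[v.adicCompletion K] := by
  rw [HeightOneSpectrum.mem_adicCompletionIntegers, Valuation.mem_integer_iff,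
    ← Valuation.vle_one_iff (Valued.v : Valuation (v.adicCompletion K) (WithZero (Multiplicative ℤ))),
    Valuation.vle_one_iff (ValuativeRel.valuation (v.adicCompletion K))]

/-- **`\bar 𝓞_v` is the closed unit ball of `algNorm K_v`**: `x ∈ v.localAbsIntegers ↔ ‖x‖ ≤ 1`
(`Literature.NumberTheory.GaloisRepresentations.mem_absIntegers_iff_spectralNorm_le_one` for the valuation norm `nontriviallyNormedField K_v`
of the GalRep files, whose closed unit ball in `K_v` is again `𝓞_v`: `norm_le_one_iff` and
`mem_adicCompletionIntegers_iff_mem_integer`). Neukirch, *ANT*, II (4.8), (6.2). [folklore] -/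
theorem mem_localAbsIntegers_iff_algNorm_le_one {x : AlgebraicClosure (v.adicCompletion K)} :
    x ∈ v.localAbsIntegers ↔ algNorm (v.adicCompletion K) x ≤ 1 := by
  letI := nontriviallyNormedField (v.adicCompletion K)
  exact Literature.NumberTheory.GaloisRepresentations.mem_absIntegers_iff_spectralNorm_le_one (v.adicCompletionIntegers K)
    (fun y ↦ (mem_adicCompletionIntegers_iff_mem_integer v y).trans
      (norm_le_one_iff (v.adicCompletion K) y).symm)

variable {v}

/-- `algNorm K_v x < 1` iff `x ≠ 0 → x⁻¹ ∉ \bar 𝓞_v`... in the form: for `x` with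
`algNorm x ≤ 1`, `algNorm x < 1 ↔ ¬ algNorm x⁻¹ ≤ 1` (unless `x = 0`). Auxiliary. [folklore] -/
theorem algNorm_lt_one_iff_of_ne_zero {x : AlgebraicClosure (v.adicCompletion K)} (hx : x ≠ 0) :
    algNorm (v.adicCompletion K) x < 1 ↔ ¬ algNorm (v.adicCompletion K) x⁻¹ ≤ 1 := by
  rw [algNorm_inv, not_le]
  have h0 : 0 < algNorm (v.adicCompletion K) x := algNorm_pos_iff.mpr hx
  constructor
  · intro h; exact one_lt_inv_iff₀.mpr ⟨h0, h⟩
  · intro h; exact (one_lt_inv_iff₀.mp h).2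

section SpectralValuation

variable {w : Valuation (AlgebraicClosure (v.adicCompletion K)) ℝ≥0}
  (hw : ∀ x, (w x : ℝ) =
    spectralNorm (v.adicCompletion K) (AlgebraicClosure (v.adicCompletion K)) x)
include hw

/-- **The two norms of `K̄_v` have the same closed unit ball**: `|x|_v ≤ 1 ↔ algNorm K_v x ≤ 1`
(both are `x ∈ \bar 𝓞_v`). [folklore] -/
theorem spectralValuation_le_one_iff_algNorm_le_one (x : AlgebraicClosure (v.adicCompletion K)) :
    w x ≤ 1 ↔ algNorm (v.adicCompletion K) x ≤ 1 := by
  rw [← mem_localAbsIntegers_iff_spectralValuation hw, mem_localAbsIntegers_iff_algNorm_le_one]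

/-- **… and the same open unit ball**: `|x|_v < 1 ↔ algNorm K_v x < 1`. [folklore] -/
theorem spectralValuation_lt_one_iff_algNorm_lt_one (x : AlgebraicClosure (v.adicCompletion K)) :
    w x < 1 ↔ algNorm (v.adicCompletion K) x < 1 := by
  by_cases hx : x = 0
  · subst hx
    simp only [map_zero, zero_lt_one, algNorm_zero]
  rw [algNorm_lt_one_iff_of_ne_zero hx, ← spectralValuation_le_one_iff_algNorm_le_one hw,
    map_inv₀, not_le, one_lt_inv_iff₀]
  exact ⟨fun h ↦ ⟨(map_ne_zero w).mpr hx |>.bot_lt, h⟩, fun h ↦ h.2⟩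

/-- **… hence the same unit sphere**: `|x|_v = 1 ↔ algNorm K_v x = 1`. [folklore] -/
theorem spectralValuation_eq_one_iff_algNorm_eq_one (x : AlgebraicClosure (v.adicCompletion K)) :
    w x = 1 ↔ algNorm (v.adicCompletion K) x = 1 := by
  constructor
  · intro h
    have h1 : w x ≤ 1 := h.le
    have h2 : ¬ w x < 1 := by rw [h]; exact lt_irrefl 1
    rw [spectralValuation_le_one_iff_algNorm_le_one hw] at h1
    rw [spectralValuation_lt_one_iff_algNorm_lt_one hw] at h2
    exact le_antisymm h1 (not_lt.mp h2)
  · intro h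
    have h1 : algNorm (v.adicCompletion K) x ≤ 1 := h.le
    have h2 : ¬ algNorm (v.adicCompletion K) x < 1 := by rw [h]; exact lt_irrefl 1
    rw [← spectralValuation_le_one_iff_algNorm_le_one hw] at h1
    rw [← spectralValuation_lt_one_iff_algNorm_lt_one hw] at h2
    exact le_antisymm h1 (not_lt.mp h2)

/-- Elements with the same `algNorm` have the same spectral valuation. [folklore] -/
theorem spectralValuation_eq_of_algNorm_eq {x y : AlgebraicClosure (v.adicCompletion K)}
    (hy : y ≠ 0) (h : algNorm (v.adicCompletion K) x = algNorm (v.adicCompletion K) y) :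
    w x = w y := by
  have hy' : algNorm (v.adicCompletion K) y ≠ 0 := fun h0 ↦ hy (algNorm_eq_zero_iff.mp h0)
  have h1 : algNorm (v.adicCompletion K) (x / y) = 1 := by rw [algNorm_div, h, div_self hy']
  have h2 : w (x / y) = 1 := (spectralValuation_eq_one_iff_algNorm_eq_one hw _).mpr h1
  rw [map_div₀, div_eq_one_iff_eq ((map_ne_zero w).mpr hy)] at h2
  exact h2

/-! ## The inertia group and the maximal unramified extension -/

/-- **`𝔐.inertia Γ_{K_v} = absInertia K_v`** for a prime `𝔐 ∈ v.localPrimesAbove`: both are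
`{σ | ‖σ b - b‖ < 1 for all ‖b‖ ≤ 1}` (`Literature.NumberTheory.GaloisRepresentations.mem_inertia_iff_spectralNorm`,
`mem_absInertia_iff_algNorm`). Neukirch, *ANT*, II (9.3). [folklore] -/
theorem inertia_eq_absInertia {𝔐 : Ideal v.localAbsIntegers} (h𝔐 : 𝔐 ∈ v.localPrimesAbove) :
    𝔐.inertia (absoluteGaloisGroup (v.adicCompletion K)) = absInertia (v.adicCompletion K) := by
  ext σ
  rw [mem_absInertia_iff_algNorm, mem_inertia_iff_spectralValuation hw h𝔐]
  refine forall_congr' fun b ↦ ?_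
  rw [spectralValuation_le_one_iff_algNorm_le_one hw, spectralValuation_lt_one_iff_algNorm_lt_one hw]

omit hw in
/-- `K̄_v / K_v` is Galois (characteristic `0`). [folklore] -/
theorem isGalois_algebraicClosure_adicCompletion :
    IsGalois (v.adicCompletion K) (AlgebraicClosure (v.adicCompletion K)) := by
  haveI : CharZero (v.adicCompletion K) :=
    charZero_of_injective_algebraMap (algebraMap K (v.adicCompletion K)).injective
  exact IsAlgClosure.isGalois _ _

/-- **The fixed field of the inertia group `I_𝔐 ≤ Γ_{K_v}` is the maximal unramified extension
`maxUnramified K_v = K_v(μ_{p'})`** (Neukirch, *ANT*, Ch. II, Def. (9.10) and Prop. (9.11): the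
inertia field is the maximal unramified extension; here: `I_𝔐 = absInertia K_v = Aut(K̄_v/K_v^nr)`
by `mem_absInertia_iff_forall_mem_maxUnramified`, and the Galois correspondence for the Galois
extension `K̄_v/K_v`, Mathlib `InfiniteGalois.fixedField_fixingSubgroup`): `x ∈ maxUnramified K_v`
iff `σ x = x` for every `σ ∈ I_𝔐`.
[cite: NeukirchANT1999, Ch. II Def. (9.10) and Prop. (9.11)] -/
theorem mem_maxUnramified_iff_forall_inertia {𝔐 : Ideal v.localAbsIntegers}
    (h𝔐 : 𝔐 ∈ v.localPrimesAbove) {x : AlgebraicClosure (v.adicCompletion K)} :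
    x ∈ maxUnramified (v.adicCompletion K) ↔
      ∀ σ ∈ 𝔐.inertia (absoluteGaloisGroup (v.adicCompletion K)),
        absoluteGaloisGroup.toAlgEquiv (v.adicCompletion K) σ x = x := by
  haveI := isGalois_algebraicClosure_adicCompletion (v := v)
  rw [inertia_eq_absInertia hw h𝔐]
  constructor
  · intro hx σ hσ
    exact (mem_absInertia_iff_forall_mem_maxUnramified.mp hσ) x hx
  · intro h
    -- `x` lies in the fixed field of `fixingSubgroup (maxUnramified K_v)`, which is `maxUnramified`
    have hfix : x ∈ IntermediateField.fixedField
        (maxUnramified (v.adicCompletion K)).fixingSubgroup := by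
      rw [IntermediateField.mem_fixedField_iff]
      intro f hf
      have hσ : (absoluteGaloisGroup.toAlgEquiv (v.adicCompletion K)).symm f ∈
          absInertia (v.adicCompletion K) := by
        rw [mem_absInertia_iff_forall_mem_maxUnramified]
        intro y hy
        exact (IntermediateField.mem_fixingSubgroup_iff _ _).mp hf y hy
      have := h _ hσ
      simpa using this
    rwa [InfiniteGalois.fixedField_fixingSubgroup] at hfix

omit hw in
/-- `algNorm` of an integer power. [folklore] -/
theorem algNorm_zpow' (x : AlgebraicClosure (v.adicCompletion K)) (n : ℤ) :
    algNorm (v.adicCompletion K) (x ^ n) = algNorm (v.adicCompletion K) x ^ n := by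
  cases n with
  | ofNat n => rw [Int.ofNat_eq_natCast, zpow_natCast, zpow_natCast, algNorm_pow]
  | negSucc n => rw [zpow_negSucc, zpow_negSucc, algNorm_inv, algNorm_pow]

/-- **The maximal unramified extension has the value group of `K_v`** (Neukirch, *ANT*, Ch. II,
Prop. (7.5): "the value group of `T` equals that of `K`", with Prop. (9.11); Serre, *Local
Fields*, IV §4 Prop. 16, Cor. 2): every `x ≠ 0` in `maxUnramified K_v` has `|x|_v = |a|_v` for some
`a ∈ K_v` (namely `a = ϖ ^ n`), by `exists_algNorm_eq_zpow_of_mem_maxUnramified`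
(`UnramifiedKummer`) and `spectralValuation_eq_of_algNorm_eq`.
[cite: NeukirchANT1999, Ch. II Prop. (7.5) with Prop. (9.11)] -/
theorem exists_spectralValuation_eq_of_mem_maxUnramified
    {x : AlgebraicClosure (v.adicCompletion K)} (hx : x ∈ maxUnramified (v.adicCompletion K))
    (hx0 : x ≠ 0) :
    ∃ a : v.adicCompletion K,
      w x = w (algebraMap (v.adicCompletion K) (AlgebraicClosure (v.adicCompletion K)) a) := by
  obtain ⟨ϖ, hϖ⟩ := IsDiscreteValuationRing.exists_irreducible (𝒪[v.adicCompletion K])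
  obtain ⟨n, hn⟩ := exists_algNorm_eq_zpow_of_mem_maxUnramified hϖ hx hx0
  have hϖ0 : (algebraMap (𝒪[v.adicCompletion K]) (AlgebraicClosure (v.adicCompletion K)) ϖ) ≠ 0 :=
    (algNorm_pos_iff.mp (algNorm_uniformizer_pos hϖ))
  refine ⟨((ϖ : 𝒪[v.adicCompletion K]) : v.adicCompletion K) ^ n,
    spectralValuation_eq_of_algNorm_eq hw ?_ ?_⟩
  · rw [map_zpow₀]
    exact zpow_ne_zero n hϖ0
  · rw [hn, map_zpow₀, algNorm_zpow']
    rfl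

end SpectralValuation

end IsDedekindDomain.HeightOneSpectrum

end
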